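import Mathlib

set_option linter.dupNamespace false

/-!
# ImprimitiveDescentLadderETF — the EIGEN-TWIST FACTORISATION lemma (pure multiset algebra)

Census instrument I-L1g16.1 of the decomp-langlands cell (lens-1 gen 16 node `ImprimitiveDescentLadder` on
C = `TwistControlLadder.CriticalOrImprimitiveDescent`, stmt-Langlands-27841; RUNME §3): the stub
`stub_eigenTwistFactorisation` (key ETF of `nodes/lens-1-g16-ImprimitiveDescentLadder.birth_stubs.json`) of the BC3
skeleton of T_bc `TwistedBaseChangeDescent`, proved EXACTLY as registered, Mathlib-only.

Informal statement.  A commutative group Γ acts on a set X.  Let `Ma Mc : Multiset X` («Satake multisets of W_a, W_c»)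
and `Ψa Ψc : Multiset Γ` («eigen-twists»), `Ψc ≠ 0`, both without repetition, with the graded identity
`Ψc • Ma = Ψa • Mc` (as multisets: `Ψc.bind (ψ ↦ ψ • Ma) = Ψa.bind (ψ₀ ↦ ψ₀ • Mc)`) and the GENERICITY hypothesis
«the blocks `ψ • Ψa • Ma`, `ψ ∈ Ψc`, are pairwise disjoint».  Then `Ma = Ψa • D` for some `D ≤ ψ⁻¹ • Mc`, `ψ ∈ Ψc`.

Proof (the memo's «filter both sides by Ψc-type»).  Fix `ψ ∈ Ψc` and filter the identity by the predicate
`p s := s ∈ ψ • Ma`.  On the left only the block of `ψ` survives (genericity with `ψ₀ = ψ₀'`), giving `ψ • Ma`.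
On the right, for `y ∈ Mc` the truth of `p (ψ₀ • y)` does NOT depend on `ψ₀ ∈ Ψa` (genericity with the two
`ψ₀`'s exchanged — this is where commutativity of Γ enters), so the right side filters to `Ψa • E` with
`E := {y ∈ Mc | p (ψ₁ • y)}` for any fixed `ψ₁ ∈ Ψa`.  Hence `ψ • Ma = Ψa • E` and `D := ψ⁻¹ • E` works.
(If `Ψa = 0` the identity forces `Ma = 0` and `D := 0` works.)
-/

namespace Summit.Langlands.Langlands.Theorems.ImprimitiveDescentLadderETF

/-- **Eigen-twist factorisation** (stub `stub_eigenTwistFactorisation` of the T_bc birth skeleton, signature verbatim):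
from `Ψc • Ma = Ψa • Mc` with `Ψc ≠ 0`, `Ψa`, `Ψc` duplicate-free and the genericity of the blocks `ψ • Ψa • Ma`
(`ψ ∈ Ψc`), the multiset `Ma` factors as `Ψa • D` with `D ≤ ψ⁻¹ • Mc` for some `ψ ∈ Ψc`. -/
theorem eigenTwistFactorisation :
    ∀ (Γ X : Type) [CommGroup Γ] [MulAction Γ X] (Ma Mc : Multiset X) (Ψa Ψc : Multiset Γ), Ψc ≠ 0 → Ψa.Nodup → Ψc.Nodup →
      Ψc.bind (fun ψ => Ma.map (fun x => ψ • x)) = Ψa.bind (fun ψ₀ => Mc.map (fun y => ψ₀ • y)) →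
      (∀ ψ ∈ Ψc, ∀ ψ' ∈ Ψc, ψ ≠ ψ' → ∀ ψ₀ ∈ Ψa, ∀ ψ₀' ∈ Ψa, ∀ x ∈ Ma, ∀ x' ∈ Ma, ψ • ψ₀ • x ≠ ψ' • ψ₀' • x') →
      ∃ D : Multiset X, (∃ ψ ∈ Ψc, D ≤ Mc.map (fun y => ψ⁻¹ • y)) ∧ Ma = Ψa.bind (fun ψ₀ => D.map (fun x => ψ₀ • x)) := by
  intro Γ X _ _ Ma Mc Ψa Ψc hc _hna hnc heq hgen
  classical
  obtain ⟨ψ, hψ⟩ := Multiset.exists_mem_of_ne_zero hc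
  -- the degenerate case `Ψa = 0`: the identity forces `Ma = 0`
  rcases eq_or_ne Ψa 0 with ha0 | ha0
  · subst ha0
    refine ⟨0, ⟨ψ, hψ, Multiset.zero_le _⟩, ?_⟩
    have hle : Ma.map (fun x => ψ • x) ≤ Ψc.bind (fun ψ' => Ma.map (fun x => ψ' • x)) := Multiset.le_bind Ψc hψ
    rw [heq, Multiset.zero_bind, Multiset.le_zero, Multiset.map_eq_zero] at hle
    rw [hle, Multiset.zero_bind]
  obtain ⟨ψ₁, hψ₁⟩ := Multiset.exists_mem_of_ne_zero ha0
  -- commuting two twists past each other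
  have hcomm : ∀ (a b : Γ) (x : X), a • b • x = b • a • x := fun a b x => by
    rw [smul_smul, smul_smul, mul_comm]
  -- the Ψc-type predicate of the block of `ψ`
  set p : X → Prop := fun s => ∃ x ∈ Ma, s = ψ • x with hp
  -- every `ψ₀ • y` (`y ∈ Mc`, `ψ₀ ∈ Ψa`) lies in `Ψc • Ma`
  have hS : ∀ y ∈ Mc, ∀ ψ₀ ∈ Ψa, ψ₀ • y ∈ Ψc.bind (fun ψ' => Ma.map (fun x => ψ' • x)) := by
    intro y hy ψ₀ hψ₀
    rw [heq]
    exact Multiset.mem_bind.mpr ⟨ψ₀, hψ₀, Multiset.mem_map.mpr ⟨y, hy, rfl⟩⟩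
  -- KEY (genericity with the ψ₀'s exchanged): the type of `ψ₀ • y` does not depend on `ψ₀ ∈ Ψa`
  have key : ∀ y ∈ Mc, ∀ ψ₀ ∈ Ψa, ∀ ψ₀' ∈ Ψa, p (ψ₀ • y) → p (ψ₀' • y) := by
    intro y hy ψ₀ hψ₀ ψ₀' hψ₀' hpy
    obtain ⟨x, hx, hxe⟩ := hpy
    obtain ⟨ψ', hψ', hmem⟩ := Multiset.mem_bind.mp (hS y hy ψ₀' hψ₀')
    obtain ⟨x', hx', hx'e⟩ := Multiset.mem_map.mp hmem
    by_cases hne : ψ = ψ'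
    · subst hne
      exact ⟨x', hx', hx'e.symm⟩
    · exfalso
      apply hgen ψ hψ ψ' hψ' hne ψ₀' hψ₀' ψ₀ hψ₀ x hx x' hx'
      calc ψ • ψ₀' • x = ψ₀' • ψ • x := hcomm _ _ _
        _ = ψ₀' • ψ₀ • y := by rw [← hxe]
        _ = ψ₀ • ψ₀' • y := hcomm _ _ _
        _ = ψ₀ • ψ' • x' := by rw [hx'e]
        _ = ψ' • ψ₀ • x' := hcomm _ _ _
  -- filter the identity by `p`
  have hfilt := congrArg (Multiset.filter p) heq
  rw [Multiset.filter_bind, Multiset.filter_bind] at hfilt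
  -- left-hand side: only the block of `ψ` survives
  have hL : Ψc.bind (fun ψ' => (Ma.map (fun x => ψ' • x)).filter p) = Ma.map (fun x => ψ • x) := by
    rw [← Multiset.cons_erase hψ, Multiset.cons_bind]
    have h1 : (Ma.map (fun x => ψ • x)).filter p = Ma.map (fun x => ψ • x) :=
      Multiset.filter_eq_self.mpr (by
        intro s hs
        obtain ⟨x, hx, rfl⟩ := Multiset.mem_map.mp hs
        exact ⟨x, hx, rfl⟩)
    have h2 : (Ψc.erase ψ).bind (fun ψ' => (Ma.map (fun x => ψ' • x)).filter p) = 0 := by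
      rw [Multiset.bind_congr (g := fun _ => (0 : Multiset X)) ?_, Multiset.bind_zero]
      intro ψ' hψ'e
      have hψ'ne : ψ' ≠ ψ := ((Multiset.Nodup.mem_erase_iff hnc).mp hψ'e).1
      have hψ' : ψ' ∈ Ψc := Multiset.mem_of_mem_erase hψ'e
      refine Multiset.filter_eq_nil.mpr ?_
      intro s hs hps
      obtain ⟨x', hx', rfl⟩ := Multiset.mem_map.mp hs
      obtain ⟨x, hx, hxe⟩ := hps
      apply hgen ψ hψ ψ' hψ' (Ne.symm hψ'ne) ψ₁ hψ₁ ψ₁ hψ₁ x hx x' hx'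
      calc ψ • ψ₁ • x = ψ₁ • ψ • x := hcomm _ _ _
        _ = ψ₁ • ψ' • x' := by rw [← hxe]
        _ = ψ' • ψ₁ • x' := hcomm _ _ _
    rw [h1, h2, add_zero]
  -- right-hand side: the filter passes inside as ONE predicate `q`, independent of `ψ₀`
  set q : X → Prop := fun y => p (ψ₁ • y) with hq
  have hR : Ψa.bind (fun ψ₀ => (Mc.map (fun y => ψ₀ • y)).filter p) =
      Ψa.bind (fun ψ₀ => (Mc.filter q).map (fun y => ψ₀ • y)) := by
    refine Multiset.bind_congr ?_
    intro ψ₀ hψ₀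
    rw [Multiset.filter_map]
    congr 1
    refine Multiset.filter_congr ?_
    intro y hy
    exact ⟨key y hy ψ₀ hψ₀ ψ₁ hψ₁, key y hy ψ₁ hψ₁ ψ₀ hψ₀⟩
  rw [hL, hR] at hfilt
  -- untwist by `ψ⁻¹`
  refine ⟨(Mc.filter q).map (fun y => ψ⁻¹ • y), ⟨ψ, hψ, Multiset.map_le_map (Multiset.filter_le q Mc)⟩, ?_⟩
  have hM : Ma = (Ma.map (fun x => ψ • x)).map (fun s => ψ⁻¹ • s) := by
    rw [Multiset.map_map]
    conv_lhs => rw [← Multiset.map_id Ma]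
    refine Multiset.map_congr rfl ?_
    intro x _
    simp
  rw [hM, hfilt, Multiset.map_bind]
  refine Multiset.bind_congr ?_
  intro ψ₀ _
  rw [Multiset.map_map, Multiset.map_map]
  refine Multiset.map_congr rfl ?_
  intro y _
  exact hcomm _ _ _

end Summit.Langlands.Langlands.Theorems.ImprimitiveDescentLadderETF
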